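import Summits.Ventures.Crystal3D.Theorems.StickyWulffConstantGenericWallFloorEndBallClassOpsDefs
import Summits.Ventures.Crystal3D.Theorems.StickyWulffConstantGenericWallFloorEndBallClassInterface
import HarnessLib

/-!
# §51 interface — OPERATIONS on end-ball classes (lemmas): the recursion step «occupied ⇒ C′» and the A₂ FRAME RULE
# (crux `GenericWallFloor`, stmt-Ventures-19480, line `WallLedgerG`; cf-p1 2026-08-28T21:40Z «one 'occupied ⇒ C′' step; the A₂ frame rule as a lemma»)

HONEST FRAMING. Venture `Summits/Ventures/Crystal3D` (cell `crystal3d-full`), helper `--supports` the crux `GenericWallFloor` of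
`route-Ventures-StickyWulffConstant`, REGISTERED line `WallLedgerG`, open stub `stub_twoSlabAdhesion`.  Rung credit only; F-C1 not moved;
NOT the crux.  Census-free, standard axioms; GAP/CLASSIFICATION (`δ ≥ 5/2`) are hypotheses as upstream.

* §1 THE STEP «occupied ⇒ C′» (`C′ = C.addOwn q₀`, …EndBallClassOpsDefs): `addOwn_wf` (well-formedness is about contacts only),
  `addOwn_listed`, `IsCarrier.addOwn` (a carrier of `C` with a ball at the site `q₀` carries `C′`), **`freeSites_addOwn_subset`**
  (`C′.freeSites s ⊆ (C.freeSites s).erase q₀` — the recursion strictly shrinks the free table), and **`EndBallClass.universe_addOwn`**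
  (the universe theorem for `C′`-carriers with `C`'s shell row: contacts are unchanged).
* §2 THE A₂ FRAME RULE: `reflection_pointVec` — for `3 ∣ q ⬝ cubeInt c` the reflection `R_c` in the `{111}` plane normal to `cubeInt c`
  maps `pointVec q` to `pointVec (reflectQ3 c q)` (so class data of a Σ3 pair reflect INTEGRALLY); `IsCarrier.reflect` — a carrier of
  `C` in the frame `G` is a carrier of `C.reflect c` in the frame `R_c ≫ G`; **`EndBallClass.universe_reflect`** — for a class given in
  T-coordinates whose REFLECTED presentation is well formed (contacts ↦ slots, `(C.reflect c).wf = true`, checked per class by `decide`)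
  and a carrier `z` (frame `G`, shell row `deg z ≤ |contacts|`): every `x ∈ X` within `√3` of `z` is `z`, a listed ball `z + G·pointVec q`
  (`q ∈ C.listed`, ORIGINAL coordinates), a ball at `z + G (R_c (pointVec q′))` for a free site `q′ ∈ (C.reflect c).freeSites true` of
  the reflected class, or payer-accompanied.
WHAT THIS IS NOT: no class data, no certificate; F-C1 not moved.
-/

noncomputable section

namespace Summit.Ventures.Crystal3D.Theorems

open Summit.Ventures.Crystal3D Finset NearIdentity
open scoped InnerProductSpace

variable {X : Finset (EuclideanSpace ℝ (Fin 3))}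

/-! ### §1 The step «occupied ⇒ C′» -/

/-- The step keeps the contacts. -/
theorem EndBallClass.addOwn_contacts (C : EndBallClass) (q : Fin 3 → ℤ) : (C.addOwn q).contacts = C.contacts := rfl

/-- The step keeps well-formedness (it is a property of the contacts). -/
theorem EndBallClass.addOwn_wf (C : EndBallClass) (q : Fin 3 → ℤ) : (C.addOwn q).wf = C.wf := rfl

/-- The listed balls of `C′` are those of `C` and `q`. -/
theorem EndBallClass.addOwn_listed (C : EndBallClass) (q : Fin 3 → ℤ) : (C.addOwn q).listed = C.listed ++ [q] := by
  simp [EndBallClass.addOwn, EndBallClass.listed, List.append_assoc]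

/-- **A carrier of `C` with a ball at the site `q₀` carries `C′ = C.addOwn q₀`.** -/
theorem EndBallClass.IsCarrier.addOwn {C : EndBallClass} {A : EuclideanSpace ℝ (Fin 3) ≃ₗᵢ[ℝ] EuclideanSpace ℝ (Fin 3)}
    {z : EuclideanSpace ℝ (Fin 3)} (hcar : C.IsCarrier X A z) {q₀ : Fin 3 → ℤ} (hq₀ : z + A (pointVec q₀) ∈ X) :
    (C.addOwn q₀).IsCarrier X A z := by
  refine ⟨hcar.1, fun q hq => ?_⟩
  rw [EndBallClass.addOwn_listed, List.mem_append, List.mem_singleton] at hq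
  rcases hq with hq | rfl
  · exact hcar.2 q hq
  · exact hq₀

/-- Overlap verdicts are monotone: a site overlapping for `C` overlaps for `C′`. -/
theorem EndBallClass.overlaps_addOwn_of_overlaps (C : EndBallClass) (q₀ : Fin 3 → ℤ) {q : Fin 3 → ℤ}
    (h : C.overlaps q = true) : (C.addOwn q₀).overlaps q = true := by
  rw [EndBallClass.overlaps, Bool.or_eq_true] at h ⊢
  rcases h with h | h
  · exact Or.inl h
  · right
    rw [EndBallClass.addOwn_listed, List.any_append, Bool.or_eq_true]
    exact Or.inl h

/-- **The free table shrinks:** `C′.freeSites s ⊆ (C.freeSites s).erase q₀`. -/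
theorem EndBallClass.freeSites_addOwn_subset (C : EndBallClass) (q₀ : Fin 3 → ℤ) (s : Bool) :
    (C.addOwn q₀).freeSites s ⊆ (C.freeSites s).erase q₀ := by
  intro q hq
  rw [EndBallClass.freeSites, Finset.mem_filter] at hq
  obtain ⟨hmenu, h54, hq0, hnl, hov, hsh⟩ := hq
  rw [EndBallClass.addOwn_listed, List.mem_append, List.mem_singleton, not_or] at hnl
  refine Finset.mem_erase.2 ⟨hnl.2, Finset.mem_filter.2 ⟨hmenu, h54, hq0, hnl.1, ?_, hsh⟩⟩
  by_contra h
  have h' : C.overlaps q = true := by simpa using h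
  have := C.overlaps_addOwn_of_overlaps q₀ h'
  rw [hov] at this
  exact Bool.false_ne_true this

/-- **Universe theorem after one step.**  `C` well formed with SHARP shell row `deg z ≤ |C.contacts|` at a carrier `z` of `C` that also
has a ball at the site `q₀`: every `x ∈ X` within `√3` of `z` is `z`, a listed ball of `C′ = C.addOwn q₀` (i.e. of `C`, or the ball at
`q₀`), a ball at a free site of `C′` (`⊆ C.freeSites true \ {q₀}`), or payer-accompanied. -/
theorem EndBallClass.universe_addOwn (C : EndBallClass) (hwf : C.wf = true) {δ : ℝ} (hg : KissingGap δ)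
    (hc : KissingClassification δ) (hδ : 5 / 2 ≤ δ) (hX : ∀ p ∈ X, ∀ q ∈ X, p ≠ q → 1 ≤ dist p q)
    (A : EuclideanSpace ℝ (Fin 3) ≃ₗᵢ[ℝ] EuclideanSpace ℝ (Fin 3)) {z : EuclideanSpace ℝ (Fin 3)} (hcar : C.IsCarrier X A z)
    {q₀ : Fin 3 → ℤ} (hq₀ : z + A (pointVec q₀) ∈ X) (hrow : (X.filter fun y => dist z y = 1).card ≤ C.contacts.length)
    {x : EuclideanSpace ℝ (Fin 3)} (hx : x ∈ X) (h3 : dist x z ≤ Real.sqrt 3) :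
    x = z ∨ (∃ q ∈ (C.addOwn q₀).listed, x = z + A (pointVec q)) ∨
      (∃ q ∈ (C.addOwn q₀).freeSites true, x = z + A (pointVec q)) ∨
      ∃ y ∈ X, y ≠ z ∧ dist x y ≤ 2 ∧ (X.filter fun q => dist y q = 1).card ≤ 11 :=
  (C.addOwn q₀).universe_sharp (by rw [EndBallClass.addOwn_wf]; exact hwf) hg hc hδ hX A (hcar.addOwn hq₀) hrow hx h3

/-! ### §2 The A₂ frame rule -/

/-- `⟪c, pointVec q⟫ = (q ⬝ c)/(3√2)` for a cube vertex `c`. -/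
theorem inner_ofCubic_cubeVec_pointVec (c : Fin 8) (q : Fin 3 → ℤ) :
    ⟪ofCubic (cubeVec c), pointVec q⟫_ℝ = (sdot3 q (cubeInt c) : ℝ) / (3 * Real.sqrt 2) := by
  rw [pointVec, inner_ofCubic]
  simp only [dotProduct, Fin.sum_univ_three, cubeVec, sdot3, Int.cast_add, Int.cast_mul]
  ring

/-- `‖c‖² = 3` for a cube vertex `c`. -/
theorem norm_sq_ofCubic_cubeVec (c : Fin 8) : ‖ofCubic (cubeVec c)‖ ^ 2 = 3 := by
  rw [norm_sq_ofCubic, cubeVec_dot_self]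

/-- **The reflection acts integrally on CSL-compatible sites:** for `3 ∣ q ⬝ cubeInt c`, the reflection `R_c` in the `{111}` plane
normal to `cubeInt c` maps `pointVec q` to `pointVec (reflectQ3 c q)`. -/
theorem reflection_pointVec (c : Fin 8) {q : Fin 3 → ℤ} (h3 : (3 : ℤ) ∣ sdot3 q (cubeInt c)) :
    (ℝ ∙ ofCubic (cubeVec c))ᗮ.reflection (pointVec q) = pointVec (reflectQ3 c q) := by
  obtain ⟨m, hm⟩ := h3
  have hdiv : sdot3 q (cubeInt c) / 3 = m := by rw [hm]; simp
  rw [Submodule.reflection_orthogonal_apply, Submodule.reflection_singleton_apply, inner_ofCubic_cubeVec_pointVec]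
  have hn : ((‖ofCubic (cubeVec c)‖ : ℝ) : ℝ) ^ 2 = 3 := norm_sq_ofCubic_cubeVec c
  simp only [RCLike.ofReal_real_eq_id, id_eq] at *
  rw [hn, neg_sub, two_smul]
  apply cubicCoords_injective
  rw [cubicCoords_sub, cubicCoords_add, cubicCoords_smul, cubicCoords_ofCubic, cubicCoords_pointVec, cubicCoords_pointVec]
  ext k
  simp only [reflectQ3, Pi.sub_apply, Pi.add_apply, Pi.smul_apply, smul_eq_mul]
  rw [hdiv, hm]
  simp only [cubeVec]
  have hs : Real.sqrt 2 ≠ 0 := by positivity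
  push_cast
  field_simp
  ring

/-- The listed balls of the reflected class. -/
theorem EndBallClass.reflect_listed (C : EndBallClass) (c : Fin 8) : (C.reflect c).listed = C.listed.map (reflectQ3 c) := by
  simp [EndBallClass.reflect, EndBallClass.listed, List.map_append]

/-- The reflected class has as many contacts. -/
theorem EndBallClass.reflect_contacts_length (C : EndBallClass) (c : Fin 8) :
    (C.reflect c).contacts.length = C.contacts.length := by
  simp [EndBallClass.reflect]

/-- **Carriers transfer to the reflected presentation:** if `z` carries `C` in the frame `G` and the listed data are CSL-compatible
(`3 ∣ q ⬝ cubeInt c`), then `z` carries `C.reflect c` in the frame `R_c ≫ G` (`R_c` the reflection in the plane normal to `cubeInt c`). -/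
theorem EndBallClass.IsCarrier.reflect {C : EndBallClass} {G : EuclideanSpace ℝ (Fin 3) ≃ₗᵢ[ℝ] EuclideanSpace ℝ (Fin 3)}
    {z : EuclideanSpace ℝ (Fin 3)} (hcar : C.IsCarrier X G z) (c : Fin 8)
    (hdiv : ∀ q ∈ C.listed, (3 : ℤ) ∣ sdot3 q (cubeInt c)) :
    (C.reflect c).IsCarrier X (((ℝ ∙ ofCubic (cubeVec c))ᗮ.reflection).trans G) z := by
  refine ⟨hcar.1, fun q' hq' => ?_⟩
  rw [EndBallClass.reflect_listed, List.mem_map] at hq'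
  obtain ⟨q, hq, rfl⟩ := hq'
  rw [LinearIsometryEquiv.trans_apply, ← reflection_pointVec c (hdiv q hq), Submodule.reflection_reflection]
  exact hcar.2 q hq

/-- **THE A₂ FRAME RULE (universe theorem for a class presented in the other lattice's coordinates).**  `C` given in T-coordinates with
CSL-compatible data (`3 ∣ q ⬝ cubeInt c` on `C.listed`) whose reflected presentation `C.reflect c` is well formed (its contacts are slots);
GAP/CLASS (`δ ≥ 5/2`), `X` `1`-separated, `z` a carrier of `C` in the frame `G` with the sharp shell row `deg z ≤ |C.contacts|`.  Then every
`x ∈ X` within `√3` of `z` is `z`, a listed ball `z + G·pointVec q` (`q ∈ C.listed`), a ball `z + G (R_c (pointVec q′))` at a free site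
`q′ ∈ (C.reflect c).freeSites true` of the reflected class, or payer-accompanied. -/
theorem EndBallClass.universe_reflect (C : EndBallClass) (c : Fin 8) (hwf : (C.reflect c).wf = true)
    (hdiv : ∀ q ∈ C.listed, (3 : ℤ) ∣ sdot3 q (cubeInt c)) {δ : ℝ} (hg : KissingGap δ) (hc : KissingClassification δ)
    (hδ : 5 / 2 ≤ δ) (hX : ∀ p ∈ X, ∀ q ∈ X, p ≠ q → 1 ≤ dist p q)
    (G : EuclideanSpace ℝ (Fin 3) ≃ₗᵢ[ℝ] EuclideanSpace ℝ (Fin 3)) {z : EuclideanSpace ℝ (Fin 3)} (hcar : C.IsCarrier X G z)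
    (hrow : (X.filter fun y => dist z y = 1).card ≤ C.contacts.length)
    {x : EuclideanSpace ℝ (Fin 3)} (hx : x ∈ X) (h3 : dist x z ≤ Real.sqrt 3) :
    x = z ∨ (∃ q ∈ C.listed, x = z + G (pointVec q)) ∨
      (∃ q' ∈ (C.reflect c).freeSites true, x = z + G ((ℝ ∙ ofCubic (cubeVec c))ᗮ.reflection (pointVec q'))) ∨
      ∃ y ∈ X, y ≠ z ∧ dist x y ≤ 2 ∧ (X.filter fun q => dist y q = 1).card ≤ 11 := by
  have hrow' : (X.filter fun y => dist z y = 1).card ≤ (C.reflect c).contacts.length := by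
    rw [EndBallClass.reflect_contacts_length]; exact hrow
  rcases (C.reflect c).universe_sharp hwf hg hc hδ hX _ (hcar.reflect c hdiv) hrow' hx h3 with h | ⟨q', hq', hxq⟩ | ⟨q', hq', hxq⟩ | h
  · exact Or.inl h
  · right; left
    rw [EndBallClass.reflect_listed, List.mem_map] at hq'
    obtain ⟨q, hq, rfl⟩ := hq'
    refine ⟨q, hq, ?_⟩
    rw [hxq, LinearIsometryEquiv.trans_apply, ← reflection_pointVec c (hdiv q hq), Submodule.reflection_reflection]
  · right; right; left
    exact ⟨q', hq', by rw [hxq, LinearIsometryEquiv.trans_apply]⟩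
  · exact Or.inr (Or.inr (Or.inr h))

end Summit.Ventures.Crystal3D.Theorems

end
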